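import Mathlib
import HarnessLib
import Literature.MathematicalPhysics.StatisticalMechanics.StepOperatorBLineSecondDiffTorusFRD
import Literature.MathematicalPhysics.StatisticalMechanics.StepOperatorASecondDiffTorusFRD
import Literature.MathematicalPhysics.StatisticalMechanics.ParallelogramSecondDiff

/-!
# The `ℓ = 2` slot of `B_k` on PARALLELOGRAMS of tuning parameters (family F4b2), uniformly in `N`:
# `‖B_{q+y+z}K − B_{q+y}K − B_{q+z}K + B_qK‖_{k+1,0} ≤ b_TT · Σ|y| · Σ|z| · C`
# ([ABKM19] Lemma 12.6 (12.52) with `ℓ = 2`; Lemma 8.7 ⊗ Lemma 8.4 (`ℓ = 2`))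

From the LINE form `hamNorm_opB_lineSecondDiff_unif_of_torusFRD` (both halves of the second difference of
`q ↦ B_k^{(q)}K` along `x, x+h, x+2h`, quadratic in `h`, `N`-free) to mixed second differences on parallelograms
in the ball `Σ|·| ≤ T₀`, by `ParallelogramSecondDiff.norm_secondDiff_le_bilinear` in the Banach space
`HamSpace` (norm `‖·‖_{k+1,0}`) over the sup-normed space of matrices (`Σ|h| ≤ d²‖h‖_∞`, `‖y‖_∞ ≤ Σ|y|`,
`Σ|2h| ≤ 1` on the ball):

* **`hamNorm_opB_paraSecondDiff_unif_of_torusFRD`** — with the explicit `N`-free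
  `b_TT = 4 L^d C_{8.7} (r₀+1) A⁻¹ d⁴ (108 q_H² S² e^{4K} K² (4^dκ) + 8 q_H S K⁽²⁾ (2^dκ))`,
  `S = (3^{d+1}(2(c₁+1))^d)^{1/2}`, `c₁ = 2(2^d+R) + 2p_Φ + 1`.

This is the shape of the slot `F4b2` of `AbkmPackageSlots` (up to the `rgBT`/`activitySpace` packaging).
Everything is proved; no named fact.

## References
* S. Adams, S. Buchholz, R. Kotecký, S. Müller, arXiv:1910.13564, Lemma 8.7, Lemma 12.6 (12.52)
  [AdamsBuchholzKoteckyMuller2019].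
* S. Buchholz, J. Funct. Anal. 275 (2018), Thm 4.5 [Buchholz2016].
-/

noncomputable section

namespace Literature.MathematicalPhysics.StatisticalMechanics.GradientRG

open scoped BigOperators
open Real Set Finset MeasureTheory
open Literature.MathematicalPhysics.StatisticalMechanics.GradientFRD
  (fourierCoeff cExt cExt_of_mem IsElliptic IsUnitSymm InShell iterDiff supNorm conv ellOp isElliptic_one)
open Literature.MathematicalPhysics.StatisticalMechanics.TorusPolymer (IsPolymer numBlocks blockOf boxCorner)
open Literature.Barriers.CriticalPhenomena.LongRangePhi4.Polymer (IsConn)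
open Literature.MathematicalPhysics.QuantumFieldTheory

variable {d M : ℕ} [NeZero M]

section Package

variable {L N Mord R n ñ : ℕ} {θbar lam μ δ₁ δ₀ A𝒫 : ℝ}
    {𝒞 : Matrix (Fin d) (Fin d) ℝ → ℕ → (Fin d → ZMod M) → ℝ} {Mc : ℕ → ℝ}
    {Cα : (Fin d → ℕ) → ℕ → ℝ} {c C : ℝ} {Cℓ : ℕ → ℝ}

set_option maxHeartbeats 3200000 in
/-- **The `ℓ = 2` slot of `B_k` on parallelograms, uniformly in `N`** (family F4b2): for symmetric
`q, q+y, q+z, q+y+z` in the ball `Σ|·| ≤ T₀ ≤ ½`, `k + 1 ≤ N`, a local `C^{r₀}` activity with `‖K‖_k^{(A)} ≤ C`: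
`‖B_{q+y+z}K − B_{q+y}K − B_{q+z}K + B_qK‖_{k+1,0} ≤ b_TT · Σ|y| · Σ|z| · C`,
`b_TT = 4 L^d C_{8.7} (r₀+1) A⁻¹ d⁴ (108 q_H² S² e^{4K} K² (4^dκ) + 8 q_H S K⁽²⁾ (2^dκ))`.
[cite: AdamsBuchholzKoteckyMuller2019, Lemma 8.7 / Lemma 12.6 (12.52)] -/
theorem hamNorm_opB_paraSecondDiff_unif_of_torusFRD
    (hd : 3 ≤ d) (hMord : 1 ≤ Mord) (hMR : Mord ≤ R) (hLodd : Odd L) (hL : 2 ^ (d + 3) + 16 * R ≤ L)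
    (hM : M = L ^ N)
    (hθbar : 0 < θbar) (hlam : 0 < lam) (hn : 2 * Mord ≤ n) (hn2 : 2 ≤ n) (hnñ : n ≤ ñ)
    (hgap : d + 1 ≤ 2 * (ñ - n))
    (hc : 0 < c) (hC1 : 0 ≤ Cℓ 1) (hC2 : 0 ≤ Cℓ 2)
    (hallA : ∀ A : Matrix (Fin d) (Fin d) ℝ, IsElliptic (1 / 2 : ℝ) 2 A →
        (∀ k, 1 ≤ k → k ≤ N + 1 →
          ∑ x : Fin d → ZMod M, 𝒞 A k x = 0 ∧ ∀ x, 𝒞 A k (-x) = 𝒞 A k x) ∧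
        (∀ k, 1 ≤ k → k ≤ N + 1 → ∀ φ : (Fin d → ZMod M) → ℝ, ∑ x, φ x = 0 →
          0 ≤ ∑ x, ∑ y, φ x * 𝒞 A k (x - y) * φ y) ∧
        (∀ φ : (Fin d → ZMod M) → ℝ, ∑ x, φ x = 0 →
          ellOp A (conv (fun x => ∑ k ∈ Finset.Icc 1 (N + 1), 𝒞 A k x) φ) = φ) ∧
        (∀ k, 1 ≤ k → k ≤ N → Mc k ≤ 0 ∧
          ∀ x : Fin d → ZMod M, ((L : ℝ) ^ k) / 2 ≤ (supNorm x : ℝ) →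
            𝒞 A k x = Mc k) ∧
        (∀ k, 1 ≤ k → k ≤ N + 1 → ∀ B : Matrix (Fin d) (Fin d) ℝ, IsUnitSymm B →
          (∃ ε : ℝ, 0 < ε ∧ ∀ x : Fin d → ZMod M,
            ContDiffOn ℝ ⊤ (fun s : ℝ => 𝒞 (A + s • B) k x) (Set.Ioo (-ε) ε)) ∧
          ∀ α : Fin d → ℕ, ∑ i, α i ≤ n → ∀ ℓ : ℕ, ∀ x : Fin d → ZMod M,
            abs (iteratedDeriv ℓ (fun s : ℝ => iterDiff α (𝒞 (A + s • B) k) x) 0)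
              ≤ Cα α ℓ / (L : ℝ) ^ ((k - 1) * (d - 2 + ∑ i, α i))) ∧
        (∀ k, 1 ≤ k → k ≤ N + 1 → ∀ j : ℕ, ∀ κ : Fin d → ZMod M, κ ≠ 0 → InShell L j κ →
          (j < k →
            c / (L : ℝ) ^ (2 * (d + ñ) + 1) * (L : ℝ) ^ (2 * j)
                / (L : ℝ) ^ ((k - j) * (d - 1 + n)) ≤ (fourierCoeff (𝒞 A k) κ).re ∧
            ‖fourierCoeff (𝒞 A k) κ‖
              ≤ C * (L : ℝ) ^ (2 * (d + ñ) + 1) * (L : ℝ) ^ (2 * j)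
                  / (L : ℝ) ^ ((k - j) * (d - 1 + n))) ∧
          (k ≤ j →
            c / (L : ℝ) ^ (2 * (d + ñ) + 1) * (L : ℝ) ^ (2 * k)
                ≤ (fourierCoeff (𝒞 A k) κ).re ∧
            ‖fourierCoeff (𝒞 A k) κ‖ ≤ C * (L : ℝ) ^ (2 * k)) ∧
          ∀ B : Matrix (Fin d) (Fin d) ℝ, IsUnitSymm B → ∀ ℓ : ℕ, 1 ≤ ℓ →
            (j < k →
              ‖iteratedDeriv ℓ (fun s : ℝ => fourierCoeff (𝒞 (A + s • B) k) κ) 0‖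
                ≤ Cℓ ℓ * (L : ℝ) ^ (2 * (d + ñ) + 1) * (L : ℝ) ^ (2 * j)
                    / (L : ℝ) ^ ((k - j) * (d - 1 + ñ))) ∧
            (k ≤ j →
              ‖iteratedDeriv ℓ (fun s : ℝ => fourierCoeff (𝒞 (A + s • B) k) κ) 0‖
                ≤ Cℓ ℓ * (L : ℝ) ^ (2 * k))))
    (hB : AbkmWeightBounds L N Mord R n θbar lam μ δ₁ δ₀ A𝒫 (fun j => 𝒞 1 j)
      (abkmWeightData L N Mord R θbar (schedDelta δ₀ δ₁ N) fun j => 𝒞 1 j))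
    {k : ℕ} (hkN : k + 1 ≤ N) {pT r₀ : ℕ} (hpM : pT + d ≤ Mord) (hr₀ : 3 ≤ r₀) {h A : ℝ} (hh : 0 < h)
    (hA : 1 ≤ A) {ρ : ℝ} (hρ0 : 0 ≤ ρ) (hρ : ρ < θbar)
    {T₀ : ℝ} (hT₀ : T₀ ≤ 1 / 2) (hKT₀ : shellRatioConst c (Cℓ 1) (L : ℝ) d ñ * T₀ ≤ Real.log (1 + ρ))
    {q y z : Matrix (Fin d) (Fin d) ℝ}
    (hq : q.IsSymm ∧ ∑ i, ∑ j, |q i j| ≤ T₀) (hqy : (q + y).IsSymm ∧ ∑ i, ∑ j, |(q + y) i j| ≤ T₀)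
    (hqz : (q + z).IsSymm ∧ ∑ i, ∑ j, |(q + z) i j| ≤ T₀)
    (hqyz : (q + y + z).IsSymm ∧ ∑ i, ∑ j, |(q + y + z) i j| ≤ T₀)
    {p qH ρ'' : ℝ} (hpq : p.HolderConjugate qH) (hρ''0 : 0 ≤ ρ'') (hρ'' : ρ'' < θbar)
    (hpρ : p * (1 + ρ) ≤ 1 + ρ'')
    {K : Finset (Fin d → ZMod M) → ((Fin d → ZMod M) → ℝ) → ℂ} {C : ℝ} (hC : 0 ≤ C)
    (hK : WeakNormLE (abkmNormParams L N Mord R pT r₀ h θbar A (schedDelta δ₀ δ₁ N) fun j => 𝒞 1 j) k K C)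
    (hKd : ∀ X, ContDiff ℝ r₀ (K X))
    (hKloc : ∀ X, IsPolymer (L ^ k) X → IsConn X →
      IsGaugeLocal ((abkmNormParams L N Mord R pT r₀ h θbar A (schedDelta δ₀ δ₁ N) fun j => 𝒞 1 j).gauge k X)
        (K X)) :
    hamNorm (fieldWt h L d (k + 1)) ((L : ℝ) ^ (k + 1)) (L ^ (d * (k + 1)))
        (opB (abkmStepData L R k fun j => 𝒞 ((1 : Matrix (Fin d) (Fin d) ℝ) + (q + y + z)) j) K -
          opB (abkmStepData L R k fun j => 𝒞 ((1 : Matrix (Fin d) (Fin d) ℝ) + (q + y)) j) K -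
          opB (abkmStepData L R k fun j => 𝒞 ((1 : Matrix (Fin d) (Fin d) ℝ) + (q + z)) j) K +
          opB (abkmStepData L R k fun j => 𝒞 ((1 : Matrix (Fin d) (Fin d) ℝ) + q) j) K) ≤
      4 * ((L : ℝ) ^ d * pi2BoundConst d (((2 * R + 2 : ℕ) : ℝ) + ((d / 2 + 1 : ℕ) : ℝ)) *
          ((r₀ + 1) * A⁻¹ * (d : ℝ) ^ 4 *
            (108 * qH ^ 2 *
                Real.sqrt ((3 : ℝ) ^ (d + 1) * (((2 * ((2 * (2 ^ d + R) + 2 * pT + 1) + 1) : ℕ) : ℝ)) ^ d) ^ 2 *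
                Real.exp (4 * shellRatioConst c (Cℓ 1) (L : ℝ) d ñ) * shellRatioConst c (Cℓ 1) (L : ℝ) d ñ ^ 2 *
                (((2 : ℝ) ^ d) ^ 2 *
                  weightIntConstRho θbar ρ'' (traceConst d Mord R lam (derivSum d n fun θ' _ => Cα θ' 0)) ^ (1 / p)) +
              8 * qH * Real.sqrt ((3 : ℝ) ^ (d + 1) * (((2 * ((2 * (2 ^ d + R) + 2 * pT + 1) + 1) : ℕ) : ℝ)) ^ d) *
                shellRatioConst c (Cℓ 2) (L : ℝ) d ñ *
                ((2 : ℝ) ^ d *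
                  weightIntConstRho θbar ρ'' (traceConst d Mord R lam (derivSum d n fun θ' _ => Cα θ' 0)) ^ (1 / p))))) *
        (∑ i, ∑ j, |y i j|) * (∑ i, ∑ j, |z i j|) * C := by
  haveI : Fact (0 < h) := ⟨hh⟩
  haveI : Fact (0 < L) := ⟨hLodd.pos⟩
  have hA0 : 0 < A := by linarith
  have hq1 : 0 ≤ qH := by linarith [hpq.symm.lt]
  set K₁ := shellRatioConst c (Cℓ 1) (L : ℝ) d ñ with hK₁
  set K₂ := shellRatioConst c (Cℓ 2) (L : ℝ) d ñ with hK₂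
  have hK₁0 : 0 ≤ K₁ := shellRatioConst_nonneg hc hC1 (Nat.cast_nonneg _) d ñ
  have hK₂0 : 0 ≤ K₂ := shellRatioConst_nonneg hc hC2 (Nat.cast_nonneg _) d ñ
  set κ := weightIntConstRho θbar ρ'' (traceConst d Mord R lam (derivSum d n fun θ' _ => Cα θ' 0)) ^ (1 / p) with hκ
  have hA𝒫p : 0 ≤ weightIntConstRho θbar ρ'' (traceConst d Mord R lam (derivSum d n fun θ' _ => Cα θ' 0)) :=
    zero_le_one.trans (one_le_weightIntConstRho hθbar hρ''0 hρ''
      (traceConst_nonneg d Mord R hlam.le (derivSum_nonneg d n _)))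
  have hκ0 : 0 ≤ κ := Real.rpow_nonneg hA𝒫p _
  set S := Real.sqrt ((3 : ℝ) ^ (d + 1) * (((2 * ((2 * (2 ^ d + R) + 2 * pT + 1) + 1) : ℕ) : ℝ)) ^ d) with hS
  have hS0 : 0 ≤ S := Real.sqrt_nonneg _
  set C87 := pi2BoundConst d (((2 * R + 2 : ℕ) : ℝ) + ((d / 2 + 1 : ℕ) : ℝ)) with hC87
  have hC870 : 0 ≤ C87 := pi2BoundConst_nonneg d (by positivity)
  -- the `HamSpace`-valued function on the sup-normed space of matrices and the convex ball
  set s : Set (Fin d → Fin d → ℝ) := {m | (Matrix.of m).IsSymm ∧ ∑ i, ∑ j, |m i j| ≤ T₀} with hs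
  have hsc : Convex ℝ s := convex_symmBall T₀
  set f : (Fin d → Fin d → ℝ) → HamSpace ℂ d (fieldWt h (L : ℝ) d (k + 1)) ((L : ℝ) ^ (k + 1)) (L ^ (d * (k + 1))) :=
    fun m => HamSpace.ofHam (opB (abkmStepData L R k fun j => 𝒞 ((1 : Matrix (Fin d) (Fin d) ℝ) + Matrix.of m) j) K)
    with hf
  set Mc : ℝ := (L : ℝ) ^ d * C87 * C * (r₀ + 1) * A⁻¹ * (d : ℝ) ^ 4 *
    (108 * qH ^ 2 * S ^ 2 * Real.exp (4 * K₁) * K₁ ^ 2 * (((2 : ℝ) ^ d) ^ 2 * κ) +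
      8 * qH * S * K₂ * ((2 : ℝ) ^ d * κ)) with hMc
  have hMc0 : 0 ≤ Mc := by positivity
  -- the line hypothesis
  have hline : ∀ x w : Fin d → Fin d → ℝ, x ∈ s → x + w ∈ s → x + (2 : ℝ) • w ∈ s →
      ‖f (x + (2 : ℝ) • w) - (2 : ℝ) • f (x + w) + f x‖ ≤ Mc * ‖w‖ ^ 2 := by
    intro x w hx hxw hx2w
    have hwsymm : (Matrix.of w).IsSymm := by
      have : Matrix.of w = Matrix.of (x + w) - Matrix.of x := by simp
      rw [this]; exact hxw.1.sub hx.1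
    have hl := hamNorm_opB_lineSecondDiff_unif_of_torusFRD hd hMord hMR hLodd hL hM hθbar hlam hn hn2 hnñ hgap hc hC1
      hC2 hallA hB hkN hpM hr₀ hh hA hρ0 hρ hT₀ hKT₀ (q := Matrix.of x) (y := Matrix.of w) hx.1 hwsymm hx.2 hxw.2
      hx2w.2 hpq hρ''0 hρ'' hpρ hC hK hKd hKloc
    -- sizes of the direction
    set T₁ := ∑ i, ∑ j, |w i j| with hT₁
    have hT₁0 : 0 ≤ T₁ := sum_nonneg fun _ _ => sum_nonneg fun _ _ => abs_nonneg _
    have hT₂ : ∑ i, ∑ j, |((2 : ℝ) • Matrix.of w) i j| = 2 * T₁ := by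
      rw [hT₁, mul_sum]
      refine sum_congr rfl fun i _ => ?_
      rw [mul_sum]
      refine sum_congr rfl fun j _ => ?_
      simp [abs_mul]
    have hT₂le : 2 * T₁ ≤ 1 := by
      have h1 : ∑ i, ∑ j, |((2 : ℝ) • w) i j| ≤ ∑ i, ∑ j, (|(x + (2 : ℝ) • w) i j| + |x i j|) := by
        refine sum_le_sum fun i _ => sum_le_sum fun j _ => ?_
        have : ((2 : ℝ) • w) i j = (x + (2 : ℝ) • w) i j - x i j := by simp
        rw [this]; exact abs_sub _ _
      have h2 : ∑ i, ∑ j, (|(x + (2 : ℝ) • w) i j| + |x i j|) =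
          (∑ i, ∑ j, |(x + (2 : ℝ) • w) i j|) + ∑ i, ∑ j, |x i j| := by
        rw [← sum_add_distrib]; exact sum_congr rfl fun i _ => sum_add_distrib
      have h3 : ∑ i, ∑ j, |((2 : ℝ) • w) i j| = 2 * T₁ := hT₂
      linarith [hx.2, hx2w.2, hT₀]
    have hTn : T₁ ≤ (d : ℝ) ^ 2 * ‖w‖ := entrySum_le_sq_mul_norm w
    rw [hT₂] at hl
    have hfx : f (x + (2 : ℝ) • w) - (2 : ℝ) • f (x + w) + f x =
        HamSpace.ofHam (opB (abkmStepData L R k fun j => 𝒞 ((1 : Matrix (Fin d) (Fin d) ℝ) +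
            (Matrix.of x + (2 : ℝ) • Matrix.of w)) j) K -
          (2 : ℝ) • opB (abkmStepData L R k fun j => 𝒞 ((1 : Matrix (Fin d) (Fin d) ℝ) +
            (Matrix.of x + Matrix.of w)) j) K +
          opB (abkmStepData L R k fun j => 𝒞 ((1 : Matrix (Fin d) (Fin d) ℝ) + Matrix.of x) j) K) := rfl
    rw [hfx, HamSpace.norm_def, HamSpace.toHam_ofHam]
    refine hl.trans ?_
    have hE : 2 * T₁ * Real.exp (2 * K₁ * (2 * T₁)) * K₁ ≤ 2 * ((d : ℝ) ^ 2 * ‖w‖) * Real.exp (2 * K₁) * K₁ := by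
      have hexp : Real.exp (2 * K₁ * (2 * T₁)) ≤ Real.exp (2 * K₁) := by
        refine Real.exp_le_exp.2 ?_
        calc 2 * K₁ * (2 * T₁) ≤ 2 * K₁ * 1 := mul_le_mul_of_nonneg_left hT₂le (by positivity)
          _ = 2 * K₁ := mul_one _
      gcongr
    have hE0 : 0 ≤ 2 * T₁ * Real.exp (2 * K₁ * (2 * T₁)) * K₁ := by positivity
    have hexp2 : Real.exp (2 * K₁) ^ 2 = Real.exp (4 * K₁) := by
      rw [← Real.exp_nat_mul]; congr 1; ring
    calc (L : ℝ) ^ d * (C87 * (C * ((r₀ + 1) * (27 * qH ^ 2 * (S * (2 * T₁ * Real.exp (2 * K₁ * (2 * T₁)) * K₁)) ^ 2)) *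
            (((2 : ℝ) ^ d) ^ 2 * κ) * A⁻¹)) +
          2 * ((L : ℝ) ^ d * (C87 * (C * ((r₀ + 1) * (8 * qH * (S * (2⁻¹ * T₁ ^ 2 * K₂)))) *
            ((2 : ℝ) ^ d * κ) * A⁻¹)))
        ≤ (L : ℝ) ^ d * (C87 * (C * ((r₀ + 1) * (27 * qH ^ 2 * (S * (2 * ((d : ℝ) ^ 2 * ‖w‖) * Real.exp (2 * K₁) * K₁)) ^ 2)) *
            (((2 : ℝ) ^ d) ^ 2 * κ) * A⁻¹)) +
          2 * ((L : ℝ) ^ d * (C87 * (C * ((r₀ + 1) * (8 * qH * (S * (2⁻¹ * ((d : ℝ) ^ 2 * ‖w‖) ^ 2 * K₂)))) *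
            ((2 : ℝ) ^ d * κ) * A⁻¹))) := by
          gcongr
      _ = Mc * ‖w‖ ^ 2 := by
          rw [hMc, mul_pow, mul_pow, mul_pow, mul_pow, hexp2]
          ring
  -- apply the bilinear lemma
  have hq' : (q : Fin d → Fin d → ℝ) ∈ s := hq
  have hqy' : (q : Fin d → Fin d → ℝ) + y ∈ s := hqy
  have hqz' : (q : Fin d → Fin d → ℝ) + z ∈ s := hqz
  have hqyz' : (q : Fin d → Fin d → ℝ) + y + z ∈ s := hqyz
  have hbil := norm_secondDiff_le_bilinear hsc hMc0 hline hq' hqy' hqz' hqyz'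
  have hbil' : ‖(HamSpace.ofHam
      (opB (abkmStepData L R k fun j => 𝒞 ((1 : Matrix (Fin d) (Fin d) ℝ) + (q + y + z)) j) K -
          opB (abkmStepData L R k fun j => 𝒞 ((1 : Matrix (Fin d) (Fin d) ℝ) + (q + y)) j) K -
          opB (abkmStepData L R k fun j => 𝒞 ((1 : Matrix (Fin d) (Fin d) ℝ) + (q + z)) j) K +
          opB (abkmStepData L R k fun j => 𝒞 ((1 : Matrix (Fin d) (Fin d) ℝ) + q) j) K) :
        HamSpace ℂ d (fieldWt h (L : ℝ) d (k + 1)) ((L : ℝ) ^ (k + 1)) (L ^ (d * (k + 1))))‖ ≤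
      4 * Mc * ‖Matrix.of.symm y‖ * ‖Matrix.of.symm z‖ := hbil
  rw [HamSpace.norm_def, HamSpace.toHam_ofHam] at hbil'
  refine hbil'.trans ?_
  have hy' : ‖Matrix.of.symm y‖ ≤ ∑ i, ∑ j, |y i j| := norm_le_entrySum _
  have hz' : ‖Matrix.of.symm z‖ ≤ ∑ i, ∑ j, |z i j| := norm_le_entrySum _
  have hMc4 : 0 ≤ 4 * Mc := by positivity
  calc 4 * Mc * ‖Matrix.of.symm y‖ * ‖Matrix.of.symm z‖
      ≤ 4 * Mc * (∑ i, ∑ j, |y i j|) * (∑ i, ∑ j, |z i j|) :=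
        mul_le_mul (mul_le_mul_of_nonneg_left hy' hMc4) hz' (norm_nonneg _) (mul_nonneg hMc4 (entrySum_nonneg y))
    _ = _ := by rw [hMc]; ring

end Package

end Literature.MathematicalPhysics.StatisticalMechanics.GradientRG

end
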